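import Mathlib
import Summits.NavierStokesRegularity.NavierStokesRegularity.Theorems.FilamentSkeletonRssStadiumChord

/-!
# Route `FilamentSkeletonRss` · child crux `TangentSkeletonNearStraightL` (stmt-NavierStokesRegularity-23320) · registered line
# `child_tangent_analytic_strip_L` (b0b56c52900dd90a), stub `stub_stripPropagation` — brick: THE PRINCIPAL-BRANCH CONDITION NEAR THE DIAGONAL

The hypothesis `hpos` of `Theorems.StadiumNearPieceHolomorphic.differentiableOn_nearPiece` and of `Theorems.StadiumNearKernelBound.near_kernel_norm_le`,
derived from the landed pieces: unit speed continued bilinearly (`Σᵢ(F′)ᵢ² ≡ 1`), the tangent modulus `‖F′ − t̄‖ ≤ η` along the shifted segment with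
`6η² ≤ 1` (`Theorems.StadiumTangentModulus(Lower)` via `Theorems.StadiumTwoConstants`), and a core-area real part `Re G(z+s) ≥ g₀ > 0`
(`StadiumAnalyticArea` + the floor `Λ⁻¹ ≤ A`), `κ > 0`:
`Re(Σᵢ(Fᵢ(z+s) − Fᵢ(z))² + κ·G(z+s)) ≥ (1 − 6η²)s² + κ g₀ > 0` (`re_chord_add_core_pos`).
HONEST FRAMING: a brick for a plan about a HYPOTHETICAL filament skeleton on the NEGATIVE side of a MODEL route; the stub `stub_stripPropagation` is NOT
closed; nothing here bears on Navier–Stokes regularity or blow-up.  `--supports stmt-NavierStokesRegularity-23320`.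
-/

set_option linter.dupNamespace false

noncomputable section

namespace Summit.NavierStokesRegularity.NavierStokesRegularity.Theorems.StadiumNearPositivity

open Set

/-- **Principal branch near the diagonal, with the core term.**  Under `Σᵢ(F′)ᵢ² = 1` on an open `U`, the horizontal segment `z + [0,s] ⊆ U`,
`‖F′(z+r) − t̄‖ ≤ η` along it with `6η² ≤ 1`, `0 < κ` and `g₀ ≤ Re Gv` (`0 < g₀`):
`(1 − 6η²)s² + κ g₀ ≤ Re(Σᵢ(Fᵢ(z+s) − Fᵢ(z))² + κ·Gv)` and in particular the right side is positive. [folklore] -/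
theorem re_chord_add_core_ge {U : Set ℂ} (hU : IsOpen U) {F : ℂ → (Fin 3 → ℂ)} (hF : DifferentiableOn ℂ F U)
    (hunit : ∀ w ∈ U, ∑ i, (deriv F w i) ^ 2 = 1) {z : ℂ} {s η κ g₀ : ℝ} {Gv : ℂ} (tbar : Fin 3 → ℂ)
    (hseg : ∀ r ∈ Set.uIcc 0 s, z + (r : ℂ) ∈ U)
    (hη : ∀ r ∈ Set.uIcc 0 s, ‖deriv F (z + (r : ℂ)) - tbar‖ ≤ η)
    (hκ : 0 ≤ κ) (hG : g₀ ≤ Gv.re) :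
    (1 - 6 * η ^ 2) * s ^ 2 + κ * g₀ ≤ ((∑ i, (F (z + (s : ℂ)) i - F z i) ^ 2) + (κ : ℂ) * Gv).re := by
  have h := Summit.NavierStokesRegularity.NavierStokesRegularity.Theorems.StadiumChord.chord_sq_re_ge_of_near_const hU hF hunit tbar hseg hη
  rw [Complex.add_re, Complex.re_ofReal_mul]
  have h2 : κ * g₀ ≤ κ * Gv.re := mul_le_mul_of_nonneg_left hG hκ
  linarith

/-- **Positivity.**  With `6η² ≤ 1`, `0 < κ`, `0 < g₀` the real part above is positive. [folklore] -/
theorem re_chord_add_core_pos {U : Set ℂ} (hU : IsOpen U) {F : ℂ → (Fin 3 → ℂ)} (hF : DifferentiableOn ℂ F U)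
    (hunit : ∀ w ∈ U, ∑ i, (deriv F w i) ^ 2 = 1) {z : ℂ} {s η κ g₀ : ℝ} {Gv : ℂ} (tbar : Fin 3 → ℂ)
    (hseg : ∀ r ∈ Set.uIcc 0 s, z + (r : ℂ) ∈ U)
    (hη : ∀ r ∈ Set.uIcc 0 s, ‖deriv F (z + (r : ℂ)) - tbar‖ ≤ η) (hη6 : 6 * η ^ 2 ≤ 1)
    (hκ : 0 < κ) (hg₀ : 0 < g₀) (hG : g₀ ≤ Gv.re) :
    0 < ((∑ i, (F (z + (s : ℂ)) i - F z i) ^ 2) + (κ : ℂ) * Gv).re := by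
  have h := re_chord_add_core_ge hU hF hunit tbar hseg hη hκ.le hG
  have h1 : 0 ≤ (1 - 6 * η ^ 2) * s ^ 2 := mul_nonneg (by linarith) (sq_nonneg s)
  have h2 : 0 < κ * g₀ := mul_pos hκ hg₀
  linarith

end Summit.NavierStokesRegularity.NavierStokesRegularity.Theorems.StadiumNearPositivity

end
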